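import Mathlib.FieldTheory.Galois.Infinite
import Mathlib.NumberTheory.NumberField.InfinitePlace.TotallyRealComplex
import Mathlib.RingTheory.Polynomial.RationalRoot
import Mathlib.Algebra.Polynomial.SpecificDegree
import Literature.NumberTheory.GaloisRepresentations.ModNCyclotomicCharacter
import HarnessLib

/-!
# The mod `p` cyclotomic character of a (totally) real field is onto for `p = 3, 5, 7` (proofs)

Topic `Literature/NumberTheory/GaloisRepresentations`; a *proofs* file (theorems only, no
definitions, no named facts). For a field `K` of characteristic zero with a real embedding
`φ : K →+* ℝ` and the tree's mod `p` cyclotomic character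
`modPCyclotomicCharacterZMod K p : Γ_K →* (ℤ/p)ˣ` (`ModPGaloisRep.lean`; `σ ζ = ζ ^ χ̄_p(σ)` on
`μ_p(K̄)`), we prove that `χ̄_p` is ONTO in the three cases used by Freitas–Le Hung–Siksek 2015,
§4.2, proof of Corollary 2.1 ("The field `K` is real quadratic, so for `p = 3, 7`, we have
`K ∩ ℚ(ζ_p) = ℚ`. For `p = 5` this holds once we have imposed the condition `K ≠ ℚ(√5)`";
`K ∩ ℚ(ζ_p) = ℚ` ⟺ `Gal(K(ζ_p)/K) = (ℤ/p)ˣ` ⟺ `χ̄_p(Γ_K) = 𝔽_pˣ`, which is hypothesis (iii)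
"`det(G) = 𝔽_p^*`" of their Prop. 1.1 once `det ρ̄_{E,p} = χ̄_p`):

* `modPCyclotomicCharacterZMod_three_surjective` — `p = 3`, any such `K`;
* `modPCyclotomicCharacterZMod_five_surjective` — `p = 5`, unless `IsSquare (5 : K)`;
* `modPCyclotomicCharacterZMod_seven_surjective` — `p = 7`, `K` a number field with
  `¬ 3 ∣ [K : ℚ]` (e.g. real quadratic).

## Proofs (elementary; not the source's, which just quotes `K ∩ ℚ(ζ_p) = ℚ`)

A complex conjugation `c ∈ Γ_K` (`exists_isComplexConjugation`) has `χ̄_p(c) = -1`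
(`modNCyclotomicCharacter_of_isComplexConjugation`), which settles `p = 3`. For `p = 5, 7` a
finite check (`decide`) shows that `-1` and any unit `u ≠ ±1` generate `(ℤ/p)ˣ`, so if `χ̄_p` is
not onto it takes only the values `±1`
(`modPCyclotomicCharacterZMod_eq_one_or_eq_neg_one_of_not_surjective`) and every `σ ∈ Γ_K` maps a
primitive `p`-th root of unity `ζ ∈ K̄` to `ζ^{±1}`. Then the Gauss sum `g = ζ + ζ⁴ - ζ² - ζ³`
(`p = 5`), resp. the period `η = ζ + ζ⁻¹` (`p = 7`), is fixed by `Γ_K`, hence lies in `K`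
(`K̄/K` is Galois: `InfiniteGalois.mem_range_algebraMap_iff_fixed`); but `g² = 5`, resp. `η` is a
root of the irreducible cubic `X³ + X² - 2X - 1` (`irreducible_cubic_seven`, by the rational root
theorem `Polynomial.isInteger_of_is_root_of_monic`), so `√5 ∈ K`, resp. `3 ∣ [K : ℚ]`
(`minpoly.degree_dvd`). The polynomial identities in `ζ` are `linear_combination`s of
`1 + ζ + ⋯ + ζ^{p-1} = 0` (`IsPrimitiveRoot.geom_sum_eq_zero`) and `ζ^p = 1`.

## References

* [FreitasLeHungSiksek2015] N. Freitas, B. V. Le Hung, S. Siksek, *Elliptic curves over real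
  quadratic fields are modular*, Invent. Math. 201 (2015) 159–206, §4.1 Prop. 1.1 (hypothesis
  `K ∩ ℚ(ζ_p) = ℚ`) and §4.2, proof of Cor. 2.1 — held `paper:arxiv-1310.7088`, pp. 19–20 of the
  text.
* L. C. Washington, *Introduction to Cyclotomic Fields*, 2nd ed., Ch. 2 (Gauss sums, `ℚ(ζ_p)⁺`).
-/

noncomputable section

open scoped NumberField IntermediateField
open Field NumberField Polynomial

namespace Literature.NumberTheory.GaloisRepresentations

universe u

section General

variable (K : Type u) [Field K] [CharZero K] (p : ℕ) [Fact p.Prime]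

/-- An element of `K̄` fixed by `Γ_K = Gal(K̄/K)` lies in `K` (`K̄/K` is Galois in
characteristic zero; Mathlib `InfiniteGalois.mem_range_algebraMap_iff_fixed`). [folklore] -/
theorem mem_range_algebraMap_of_forall_smul_eq {x : AlgebraicClosure K}
    (hx : ∀ σ : absoluteGaloisGroup K, σ • x = x) :
    x ∈ Set.range (algebraMap K (AlgebraicClosure K)) := by
  haveI : IsGalois K (AlgebraicClosure K) := {}
  exact (InfiniteGalois.mem_range_algebraMap_iff_fixed x).mpr fun f => hx f

/-- A complex conjugation has mod `p` cyclotomic character `-1`; in particular `-1` is a value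
of `χ̄_p` on `Γ_K` as soon as `K` has a real embedding
(`exists_isComplexConjugation`, `modNCyclotomicCharacter_of_isComplexConjugation`). [folklore] -/
theorem exists_modPCyclotomicCharacterZMod_eq_neg_one (φ : K →+* ℝ) :
    ∃ c : absoluteGaloisGroup K, (modPCyclotomicCharacterZMod K p c : ZMod p) = -1 := by
  haveI : NeZero (p : K) := NeZero.charZero
  obtain ⟨c, hc⟩ := exists_isComplexConjugation φ
  exact ⟨c, by
    rw [modPCyclotomicCharacterZMod_eq_modNCyclotomicCharacter]
    exact modNCyclotomicCharacter_of_isComplexConjugation hc⟩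

end General

/-! ### Values in `{±1}` -/

section PlusMinus

variable (K : Type u) [Field K] [CharZero K] (p : ℕ) [Fact p.Prime]

/-- If `-1` is a value of `χ̄_p` and some value `u` of `χ̄_p` lies outside `{1, -1}`, and if the
elementary fact "every unit of `ℤ/p` is `u ^ k · (-1) ^ j`" holds for such `u` (true for
`p = 5, 7`, see `ZMod.exists_eq_pow_mul_neg_one_pow_five/seven`), then `χ̄_p : Γ_K → (ℤ/p)ˣ` is
onto. [folklore] -/
theorem modPCyclotomicCharacterZMod_surjective_of_exists_ne
    (haux : ∀ u v : ZMod p, u ≠ 0 → v ≠ 0 → u ≠ 1 → u ≠ -1 → ∃ k j : ℕ, v = u ^ k * (-1) ^ j)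
    (hc : ∃ c : absoluteGaloisGroup K, (modPCyclotomicCharacterZMod K p c : ZMod p) = -1)
    (hσ : ∃ σ : absoluteGaloisGroup K, (modPCyclotomicCharacterZMod K p σ : ZMod p) ≠ 1 ∧
      (modPCyclotomicCharacterZMod K p σ : ZMod p) ≠ -1) :
    Function.Surjective (modPCyclotomicCharacterZMod K p) := by
  obtain ⟨c, hc⟩ := hc
  obtain ⟨σ, hσ1, hσ2⟩ := hσ
  intro v
  obtain ⟨k, j, hkj⟩ := haux _ (v : ZMod p) (modPCyclotomicCharacterZMod K p σ).ne_zero v.ne_zero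
    hσ1 hσ2
  refine ⟨σ ^ k * c ^ j, Units.ext ?_⟩
  rw [map_mul, map_pow, map_pow, Units.val_mul, Units.val_pow_eq_pow_val, Units.val_pow_eq_pow_val,
    hc, ← hkj]

/-- Contrapositive form: if `K` has a real embedding (so that `χ̄_p(c) = -1` for a complex
conjugation `c`) and `χ̄_p` is NOT onto, then `χ̄_p` takes only the values `±1` (for `p` such
that the elementary generation fact holds, e.g. `p = 5, 7`). [folklore] -/
theorem modPCyclotomicCharacterZMod_eq_one_or_eq_neg_one_of_not_surjective
    (haux : ∀ u v : ZMod p, u ≠ 0 → v ≠ 0 → u ≠ 1 → u ≠ -1 → ∃ k j : ℕ, v = u ^ k * (-1) ^ j)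
    (φ : K →+* ℝ) (h : ¬ Function.Surjective (modPCyclotomicCharacterZMod K p))
    (σ : absoluteGaloisGroup K) :
    (modPCyclotomicCharacterZMod K p σ : ZMod p) = 1 ∨
      (modPCyclotomicCharacterZMod K p σ : ZMod p) = -1 := by
  by_contra hne
  push Not at hne
  exact h (modPCyclotomicCharacterZMod_surjective_of_exists_ne K p haux
    (exists_modPCyclotomicCharacterZMod_eq_neg_one K p φ) ⟨σ, hne⟩)

/-- Every unit of `ℤ/5` is `± u ^ k` for any unit `u ≠ ±1` (indeed `2` and `3` generate
`(ℤ/5)ˣ`); a finite check. [folklore] -/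
theorem ZMod.exists_eq_pow_mul_neg_one_pow_five :
    ∀ u v : ZMod 5, u ≠ 0 → v ≠ 0 → u ≠ 1 → u ≠ -1 → ∃ k j : ℕ, v = u ^ k * (-1) ^ j := by
  intro u v hu hv hu1 hu2
  have key : ∀ u v : ZMod 5, u ≠ 0 → v ≠ 0 → u ≠ 1 → u ≠ -1 →
      ∃ k < 4, ∃ j < 2, v = u ^ k * (-1) ^ j := by decide
  obtain ⟨k, -, j, -, h⟩ := key u v hu hv hu1 hu2
  exact ⟨k, j, h⟩

/-- Every unit of `ℤ/7` is `± u ^ k` for any unit `u ≠ ±1` (`3, 5` generate `(ℤ/7)ˣ`, and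
`2, 4` generate its index-two subgroup, which does not contain `-1`); a finite check. [folklore] -/
theorem ZMod.exists_eq_pow_mul_neg_one_pow_seven :
    ∀ u v : ZMod 7, u ≠ 0 → v ≠ 0 → u ≠ 1 → u ≠ -1 → ∃ k j : ℕ, v = u ^ k * (-1) ^ j := by
  intro u v hu hv hu1 hu2
  have key : ∀ u v : ZMod 7, u ≠ 0 → v ≠ 0 → u ≠ 1 → u ≠ -1 →
      ∃ k < 6, ∃ j < 2, v = u ^ k * (-1) ^ j := by decide
  obtain ⟨k, -, j, -, h⟩ := key u v hu hv hu1 hu2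
  exact ⟨k, j, h⟩

/-- On a primitive `p`-th root of unity `ζ ∈ K̄`, an element `σ ∈ Γ_K` with `χ̄_p(σ) = ±1` acts by
`ζ ↦ ζ` or `ζ ↦ ζ ^ (p - 1)` (`= ζ⁻¹`). [folklore] -/
theorem smul_eq_self_or_eq_pow_of_eq_one_or_eq_neg_one {ζ : AlgebraicClosure K}
    (hζ : ζ ^ p = 1) {σ : absoluteGaloisGroup K}
    (h : (modPCyclotomicCharacterZMod K p σ : ZMod p) = 1 ∨
      (modPCyclotomicCharacterZMod K p σ : ZMod p) = -1) :
    σ • ζ = ζ ∨ σ • ζ = ζ ^ (p - 1) := by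
  have hp : p.Prime := Fact.out
  haveI : NeZero (p : K) := NeZero.charZero
  have hspec := modPCyclotomicCharacterZMod_spec K p σ ζ hζ
  rcases h with h | h
  · left
    rw [hspec, h, ZMod.val_one'' hp.one_lt.ne', pow_one]
  · right
    haveI : NeZero p := ⟨hp.ne_zero⟩
    rw [hspec, h, ZMod.neg_val, if_neg one_ne_zero, ZMod.val_one'' hp.one_lt.ne']

end PlusMinus

/-! ### `p = 3`, `p = 5`, `p = 7` -/

section SmallPrimes

variable (K : Type u) [Field K] [CharZero K]

/-- **`χ̄₃` is onto** for any field `K` with a real embedding: `(ℤ/3)ˣ = {±1}` and a complex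
conjugation has `χ̄₃ = -1` (equivalently `ζ₃ ∉ K`, i.e. `K ∩ ℚ(ζ₃) = ℚ`; Freitas–Le Hung–Siksek
2015, proof of Cor. 2.1: "The field `K` is real quadratic, so for `p = 3, 7`, we have
`K ∩ ℚ(ζ_p) = ℚ`"). [folklore] -/
theorem modPCyclotomicCharacterZMod_three_surjective (φ : K →+* ℝ) :
    Function.Surjective (modPCyclotomicCharacterZMod K 3) := by
  obtain ⟨c, hc⟩ := exists_modPCyclotomicCharacterZMod_eq_neg_one K 3 φ
  intro v
  have hv : (v : ZMod 3) = 1 ∨ (v : ZMod 3) = -1 := by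
    have key : ∀ w : ZMod 3, w ≠ 0 → w = 1 ∨ w = -1 := by decide
    exact key _ v.ne_zero
  rcases hv with hv | hv
  · exact ⟨1, Units.ext (by rw [map_one, Units.val_one, hv])⟩
  · exact ⟨c, Units.ext (by rw [hc, hv])⟩

/-- **`χ̄₅` is onto unless `√5 ∈ K`**, for any field `K` of characteristic zero with a real
embedding: otherwise `χ̄₅` takes only the values `±1`
(`modPCyclotomicCharacterZMod_eq_one_or_eq_neg_one_of_not_surjective`), so the Gauss sum
`g = ζ + ζ⁴ - ζ² - ζ³` of a primitive fifth root of unity `ζ ∈ K̄` is fixed by `Γ_K`, hence lies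
in `K`, and `g² = 5`. (Freitas–Le Hung–Siksek 2015, proof of Cor. 2.1: "For `p = 5` this holds
once we have imposed the condition `K ≠ ℚ(√5)`", `K` real quadratic.) [folklore] -/
theorem modPCyclotomicCharacterZMod_five_surjective [Fact (Nat.Prime 5)] (φ : K →+* ℝ)
    (h5 : ¬ IsSquare (5 : K)) : Function.Surjective (modPCyclotomicCharacterZMod K 5) := by
  by_contra hs
  have hpm := modPCyclotomicCharacterZMod_eq_one_or_eq_neg_one_of_not_surjective K 5
    ZMod.exists_eq_pow_mul_neg_one_pow_five φ hs
  haveI : NeZero ((5 : ℕ) : K) := NeZero.charZero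
  obtain ⟨ζ, hζ⟩ := HasEnoughRootsOfUnity.exists_primitiveRoot (AlgebraicClosure K) 5
  have h1 : ζ ^ 5 = 1 := hζ.pow_eq_one
  have hΦ : 1 + ζ + ζ ^ 2 + ζ ^ 3 + ζ ^ 4 = 0 := by
    have := hζ.geom_sum_eq_zero (by norm_num : 1 < 5)
    simp only [Finset.sum_range_succ, Finset.sum_range_zero, zero_add, pow_zero, pow_one] at this
    exact this
  -- the Gauss sum `g`, fixed by `Γ_K`
  set g : AlgebraicClosure K := ζ + ζ ^ 4 - ζ ^ 2 - ζ ^ 3 with hg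
  have hfix : ∀ σ : absoluteGaloisGroup K, σ • g = g := by
    intro σ
    rcases smul_eq_self_or_eq_pow_of_eq_one_or_eq_neg_one K 5 h1 (hpm σ) with hσ | hσ
    · simp only [hg, smul_add, smul_sub, smul_pow', hσ]
    · simp only [hg, smul_add, smul_sub, smul_pow', hσ, ← pow_mul]
      norm_num
      linear_combination (ζ ^ 11 + ζ ^ 6 + ζ - ζ ^ 7 - ζ ^ 2 - ζ ^ 3) * h1
  obtain ⟨x, hx⟩ := mem_range_algebraMap_of_forall_smul_eq K hfix
  have hg2 : g ^ 2 = 5 := by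
    simp only [hg]
    linear_combination (ζ ^ 4 - 3 * ζ ^ 3 + ζ ^ 2 + 5 * ζ - 5) * hΦ
  have hx2 : x ^ 2 = 5 := by
    apply (algebraMap K (AlgebraicClosure K)).injective
    rw [map_pow, hx, hg2, map_ofNat]
  exact h5 ⟨x, by rw [← sq, hx2]⟩

/-- The cubic `X³ + X² - 2X - 1 ∈ ℚ[X]` (minimal polynomial of `ζ₇ + ζ₇⁻¹`) is irreducible: a
rational root would be an integer `n` with `n (n² + n - 2) = 1`. [folklore] -/
theorem irreducible_cubic_seven :
    Irreducible (X ^ 3 + X ^ 2 - 2 * X - 1 : ℚ[X]) := by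
  have hmonic : (X ^ 3 + X ^ 2 - 2 * X - 1 : ℚ[X]).Monic := by monicity!
  have hdeg : (X ^ 3 + X ^ 2 - 2 * X - 1 : ℚ[X]).natDegree = 3 := by compute_degree!
  rw [hmonic.irreducible_iff_roots_eq_zero_of_degree_le_three (by rw [hdeg]; norm_num) hdeg.le,
    Multiset.eq_zero_iff_forall_notMem]
  intro r hr
  rw [mem_roots hmonic.ne_zero, IsRoot.def] at hr
  -- `r` is a rational root of a monic integer cubic, hence an integer
  have hZ : (X ^ 3 + X ^ 2 - 2 * X - 1 : ℤ[X]).Monic := by monicity!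
  have hr' : aeval r (X ^ 3 + X ^ 2 - 2 * X - 1 : ℤ[X]) = 0 := by
    simp only [map_sub, map_add, map_pow, aeval_X, map_mul, map_ofNat, map_one]
    simpa using hr
  obtain ⟨n, hn⟩ := isInteger_of_is_root_of_monic hZ hr'
  have hnr : (n : ℚ) = r := hn
  have h0 : n ^ 3 + n ^ 2 - 2 * n - 1 = 0 := by
    have : ((n ^ 3 + n ^ 2 - 2 * n - 1 : ℤ) : ℚ) = 0 := by
      push_cast
      rw [hnr]
      simpa using hr
    exact_mod_cast this
  have hunit : n * (n ^ 2 + n - 2) = 1 := by linear_combination h0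
  rcases Int.eq_one_or_neg_one_of_mul_eq_one hunit with rfl | rfl <;> norm_num at h0

/-- **`χ̄₇` is onto for a number field `K` with a real embedding and degree prime to `3`** (e.g.
real quadratic: Freitas–Le Hung–Siksek 2015, proof of Cor. 2.1, "for `p = 3, 7`, we have
`K ∩ ℚ(ζ_p) = ℚ`"): otherwise `χ̄₇ = ±1` on `Γ_K`, so `η = ζ + ζ⁻¹` (`ζ ∈ K̄` a primitive
seventh root of unity) lies in `K`; it is a root of the irreducible cubic `X³ + X² - 2X - 1`, so
`3 ∣ [K : ℚ]`. [folklore] -/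
theorem modPCyclotomicCharacterZMod_seven_surjective [Fact (Nat.Prime 7)] [NumberField K]
    (φ : K →+* ℝ) (h3 : ¬ 3 ∣ Module.finrank ℚ K) :
    Function.Surjective (modPCyclotomicCharacterZMod K 7) := by
  by_contra hs
  have hpm := modPCyclotomicCharacterZMod_eq_one_or_eq_neg_one_of_not_surjective K 7
    ZMod.exists_eq_pow_mul_neg_one_pow_seven φ hs
  haveI : NeZero ((7 : ℕ) : K) := NeZero.charZero
  obtain ⟨ζ, hζ⟩ := HasEnoughRootsOfUnity.exists_primitiveRoot (AlgebraicClosure K) 7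
  have h1 : ζ ^ 7 = 1 := hζ.pow_eq_one
  have hΦ : 1 + ζ + ζ ^ 2 + ζ ^ 3 + ζ ^ 4 + ζ ^ 5 + ζ ^ 6 = 0 := by
    have := hζ.geom_sum_eq_zero (by norm_num : 1 < 7)
    simp only [Finset.sum_range_succ, Finset.sum_range_zero, zero_add, pow_zero, pow_one] at this
    exact this
  -- the period `η = ζ + ζ⁻¹`, fixed by `Γ_K`
  set η : AlgebraicClosure K := ζ + ζ ^ 6 with hη
  have hfix : ∀ σ : absoluteGaloisGroup K, σ • η = η := by
    intro σ
    rcases smul_eq_self_or_eq_pow_of_eq_one_or_eq_neg_one K 7 h1 (hpm σ) with hσ | hσ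
    · simp only [hη, smul_add, smul_pow', hσ]
    · simp only [hη, smul_add, smul_pow', hσ, ← pow_mul]
      norm_num
      linear_combination (ζ ^ 29 + ζ ^ 22 + ζ ^ 15 + ζ ^ 8 + ζ) * h1
  obtain ⟨x, hx⟩ := mem_range_algebraMap_of_forall_smul_eq K hfix
  have hη3 : η ^ 3 + η ^ 2 - 2 * η - 1 = 0 := by
    simp only [hη]
    linear_combination
      (ζ ^ 12 - ζ ^ 11 + 3 * ζ ^ 7 - 2 * ζ ^ 6 - ζ ^ 4 + 3 * ζ ^ 2 - ζ - 1) * hΦ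
  have hx3 : aeval x (X ^ 3 + X ^ 2 - 2 * X - 1 : ℚ[X]) = 0 := by
    apply (algebraMap K (AlgebraicClosure K)).injective
    simp only [map_sub, map_add, map_pow, aeval_X, map_mul, map_ofNat, map_one, map_zero, hx]
    exact hη3
  -- so the minimal polynomial of `x` over `ℚ` is the irreducible cubic, and `3 ∣ [K : ℚ]`
  have hmonic : (X ^ 3 + X ^ 2 - 2 * X - 1 : ℚ[X]).Monic := by monicity!
  have hdeg : (X ^ 3 + X ^ 2 - 2 * X - 1 : ℚ[X]).natDegree = 3 := by compute_degree!
  have hmin := minpoly.eq_of_irreducible_of_monic irreducible_cubic_seven hx3 hmonic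
  have hint : IsIntegral ℚ x := Algebra.IsIntegral.isIntegral x
  have hdvd := minpoly.degree_dvd hint
  rw [← hmin, hdeg] at hdvd
  exact h3 hdvd

end SmallPrimes

end Literature.NumberTheory.GaloisRepresentations

end
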